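import Summits.BirchSwinnertonDyer.BirchSwinnertonDyer.Theses.EisensteinPrimes
import Summits.BirchSwinnertonDyer.BirchSwinnertonDyer.Theorems.Rank1ResidualX1Defs
import Literature.NumberTheory.EllipticCurves.BSDRootNumberSmallConductorProofs

/-!
# Inert-partner parity sketch (idea g18, lens `wuc` + inert Heegner partner symmetry) for crux 5
`EisensteinPrimes.MazurMCOnX1RankZero` (stmt-BirchSwinnertonDyer-19035).

NOT a line on the crux (no `MazurMCOnX1RankZero_of` here): the crux is equivalent to BSD_p class-wide
(`mazurMCOnX1RankZero_iff_forall_bsdp`) and its open half is the LOWER bound `ord_p #Ш_an ≤ ord_p #Ш[p^∞]`.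
This file types the WEAKEST UNKNOWN CONSEQUENCE of the crux that the published record reaches WITHOUT any
Iwasawa theory at the type-A prime: the `p`-adic valuation of `#Ш_an(E)` is EVEN for every rank-0 X1 pair
(`ShaAnValuationEvenOnX1`, P1), and the three inputs of its proof plan (S1 supply, S2 Gross–Zagier square,
S3 partner evenness), with the composition `shaAnValuationEvenOnX1_of` kernel-checked (no `sorry`).

Dictionary. `(W, p)` rank-0 X1 pair (type A automatically); `K` imaginary quadratic, Heegner for `N_W`,
`p` INERT in `K` (one prime of `𝓞 K` above `p`, `p ∤ d_K`), `d_K` odd `< -4`, `ord_{s=1} L(W^{(d_K)}, s) = 1`.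
Then `a_p(W^{(d_K)}) = χ_K(p) a_p(W) = -a_p(W) ≡ -1 (mod p)`: the partner is Eisenstein, good ordinary and
NON-anomalous at `p`, so Castella–Grossi–Skinner 2025 Thm. D (tree: `CastellaGrossiSkinner2025.
thmD_padicValRat_bsd_rank_le_one`, no conductor / no Selmer-corank / no image hypothesis) gives BSD_p for it;
Cassels–Tate (`isSquare_natCard_…_sha`, with `Finite Ш` from Kolyvagin) makes `ord_p #Ш(W^{(d_K)})` even;
Gross–Zagier (`gross_zagier`, `GrossZagierFormula`, `grossZagierConstant`) + Kolyvagin index give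
`#Ш_an(W)·#Ш_an(W^{(d_K)}) = p-adic unit × square` (periods: `Ω(W/K)` vs `Ω⁺(W)Ω⁺(W^{(d_K)})` differ by a
power of 2 and `√|d_K|`, `p ∤ 2 d_K`; Tamagawa: `c_ℓ(W^{d_K}) = c_ℓ(W)` at split `ℓ ∣ N`, `∈ {1,2,4}` at
`ℓ ∣ d_K` — idea g17's typed `HeegnerTwistTamagawaRigidity`; Manin constant and `u_K = 1` are `p`-units for
`p ∤ 2N`, `d_K < -4`). Hence `ord_p #Ш_an(W)` is even.

Census falsifier (this folder `fals/x1_shaan_parity.py`, Cremona `allbsd`+`allisog`, N < 5·10⁵, 7 s):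
0 odd valuations among 22 188 (curve, p) rank-0 reducible-good-anomalous pairs in 10 143 classes
(digits {0: 20169, 2: 1980, 4: 39}); output sha256 5c7062daa6b35a72.
-/

namespace Summit.BirchSwinnertonDyer.BirchSwinnertonDyer.Cruxes.MazurMCOnX1RankZero.InertPartnerParity

open Literature.NumberTheory.EllipticCurves Literature.NumberTheory.EllipticCurves.Rank1Residual
open WeierstrassCurve NumberField

/-- **P1 (wuc of crux 5, beyond print).** For every rank-0 X1 pair `(W, p)` and the rational number
`q = #Ш_an(W)` (`shaAn`, Miller's analytic order of `Ш` for the globally minimal model), `ord_p q` is EVEN.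
Consequence of the crux (BSD_p gives `ord_p q = ord_p #Ш[p^∞]`, even by Cassels–Tate) not known in print at
type-A anomalous Eisenstein `p`; provable from S1–S3 below (`shaAnValuationEvenOnX1_of`). -/
def ShaAnValuationEvenOnX1 : Prop :=
  ∀ (W : WeierstrassCurve ℚ) [W.IsElliptic] [W.IsGloballyMinimal] (p : ℕ) [Fact p.Prime],
    ClassX1 W p → W.analyticRank = 0 → ∀ q : ℚ, shaAn W = (q : ℂ) → Even (padicValRat p q)

/-- The inert Heegner partner datum: `K` imaginary quadratic with `d_K` odd, `d_K < -4`, every `ℓ ∣ N_W`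
split in `K` (Heegner hypothesis), `p` INERT in `K` (exactly one prime of `𝓞 K` above `p` and `p ∤ d_K`),
and the twist `W^{(d_K)}` of analytic rank exactly `1`. -/
def IsInertHeegnerPartner (W : WeierstrassCurve ℚ) (p : ℕ) (K : Type) [Field K] [NumberField K] :
    Prop :=
  IsImaginaryQuadratic K ∧ Odd (NumberField.discr K) ∧ NumberField.discr K < -4 ∧
    SatisfiesHeegnerHypothesis (W.conductorNorm ℤ) K ∧
    ((Ideal.span {(p : ℤ)}).primesOver (𝓞 K)).ncard = 1 ∧ ¬ (p : ℤ) ∣ NumberField.discr K ∧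
    (W.quadraticTwist (NumberField.discr K : ℚ)).analyticRank = 1

/-- **S1 (supply; Friedberg–Hoffstein 1995 Thm. B, second alternative, with the local component at the
good prime `p` prescribed NON-trivial unramified = `p` inert; NOT yet vendored — the tree's
`bumpFriedbergHoffstein_exists_heegnerField_split_twist_simpleZero` prescribes `p` split and
`friedbergHoffstein_exists_twist_simpleZero_inertAt_splitAt` prescribes inert only at multiplicative
primes).** For `W` of analytic rank `0` (root number `+1`) and an odd good prime `p` there is an inert
Heegner partner field. The sign of the prescribed class is `w(W^{(d)}) = w(W/K) w(W) = -1`, so Thm. B (ii)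
applies. -/
def HeegnerInertSimpleZeroSupply : Prop :=
  ∀ (W : WeierstrassCurve ℚ) [W.IsElliptic] [W.IsGloballyMinimal] (p : ℕ) [Fact p.Prime],
    W.analyticRank = 0 → Good W p → p ≠ 2 →
    ∃ (K : Type) (_ : Field K) (_ : NumberField K), IsInertHeegnerPartner W p K

/-- **S2 (Gross–Zagier square, valuation form).** For a rank-0 X1 pair and an inert Heegner partner `K`,
with `Wd` a globally minimal model of `W^{(d_K)}`: `ord_p #Ш_an(W) + ord_p #Ш_an(Wd)` is even.
Inputs (all print): `gross_zagier` + Kolyvagin's index formula give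
`#Ш_an(W/K) = (I_K · #E(K)_tors / (c_Manin · u_K · ∏_{ℓ∣N} c_ℓ))²`; the quotient
`#Ш_an(W/K) / (#Ш_an(W) #Ш_an(Wd))` is `2^a · (Tamagawa at ℓ ∣ d_K ∈ {1,2,4}) · (torsion squares)`, a
`p`-adic unit times a square for `p ∤ 2 N d_K` (g17 `HeegnerTwistTamagawaRigidity`, Pal 2012 for periods). -/
def InertPartnerValuationSumEven : Prop :=
  ∀ (W : WeierstrassCurve ℚ) [W.IsElliptic] [W.IsGloballyMinimal] (p : ℕ) [Fact p.Prime],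
    ClassX1 W p → W.analyticRank = 0 →
    ∀ (K : Type) [Field K] [NumberField K], IsInertHeegnerPartner W p K →
    ∀ (Wd : WeierstrassCurve ℚ) [Wd.IsElliptic] [Wd.IsGloballyMinimal],
      (∃ C : VariableChange ℚ, C • Wd = W.quadraticTwist (NumberField.discr K : ℚ)) →
    ∀ q q' : ℚ, shaAn W = (q : ℂ) → shaAn Wd = (q' : ℂ) → Even (padicValRat p q + padicValRat p q')

/-- **S3 (partner evenness).** For a rank-0 X1 pair and an inert Heegner partner `K` there is a globally
minimal model `Wd` of `W^{(d_K)}` whose `#Ш_an` is a rational `q'` of EVEN `p`-adic valuation.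
Inputs (all print): `a_p(Wd) = -a_p(W) ≢ 1 (mod p)` (inert!) so `(Wd, p)` is Eisenstein good NON-anomalous
of analytic rank `1`; CGS 2025 Thm. D (`thmD_padicValRat_bsd_rank_le_one`) ⇒ `ord_p q' = ord_p #Ш(Wd)`
(+ Tamagawa − 2·torsion bookkeeping inside `shaAn`); Kolyvagin ⇒ `Ш(Wd)` finite; Cassels–Tate
(`isSquare_natCard_quot_divisibleElements_primaryComponent_sha`) ⇒ `#Ш(Wd)[p^∞]` is a square. -/
def InertPartnerShaAnEven : Prop :=
  ∀ (W : WeierstrassCurve ℚ) [W.IsElliptic] [W.IsGloballyMinimal] (p : ℕ) [Fact p.Prime],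
    ClassX1 W p → W.analyticRank = 0 →
    ∀ (K : Type) [Field K] [NumberField K], IsInertHeegnerPartner W p K →
    ∃ (Wd : WeierstrassCurve ℚ) (_ : Wd.IsElliptic) (_ : Wd.IsGloballyMinimal),
      (∃ C : VariableChange ℚ, C • Wd = W.quadraticTwist (NumberField.discr K : ℚ)) ∧
      ∃ q' : ℚ, shaAn Wd = (q' : ℂ) ∧ Even (padicValRat p q')

/-- **Composition (kernel-checked, no `sorry`): S1 → S2 → S3 → P1.** `ClassX1` supplies `2 < p` and
`Good W p`; S1 gives the inert partner `K`; S3 a minimal model `Wd` of the twist with `ord_p #Ш_an(Wd)`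
even; S2 the even sum; parity arithmetic (`Int.even_add`) finishes. -/
theorem shaAnValuationEvenOnX1_of (h1 : HeegnerInertSimpleZeroSupply)
    (h2 : InertPartnerValuationSumEven) (h3 : InertPartnerShaAnEven) : ShaAnValuationEvenOnX1 := by
  intro W _ _ p _ hX1 hr q hq
  have hp2 : p ≠ 2 := by have := hX1.1; omega
  have hgood : Good W p := hX1.2.2.1
  obtain ⟨K, hF, hNF, hK⟩ := h1 W p hr hgood hp2
  obtain ⟨Wd, hE, hM, hC, q', hq', hev'⟩ := h3 W p hX1 hr K hK
  have hsum : Even (padicValRat p q + padicValRat p q') := h2 W p hX1 hr K hK Wd hC q q' hq hq'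
  exact (Int.even_add.mp hsum).mpr hev'

/-- Sanity (the statement is not vacuous in the trivial direction): P1 is implied by BSD_p class-wide,
i.e. by the crux via `mazurMCOnX1RankZero_iff_forall_bsdp` — recorded here only as the valuation
arithmetic it reduces to: if `ord_p q = ord_p n` for a natural number `n` that is a square, then
`ord_p q` is even. -/
theorem even_padicValRat_of_eq_padicValNat_of_isSquare {p : ℕ} [Fact p.Prime] {q : ℚ} {n : ℕ}
    (hn : IsSquare n) (hn0 : n ≠ 0) (h : padicValRat p q = padicValNat p n) :
    Even (padicValRat p q) := by
  obtain ⟨m, rfl⟩ := hn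
  have hm : m ≠ 0 := by rintro rfl; simp at hn0
  rw [h, padicValNat.mul hm hm]
  push_cast
  exact ⟨_, rfl⟩

end Summit.BirchSwinnertonDyer.BirchSwinnertonDyer.Cruxes.MazurMCOnX1RankZero.InertPartnerParity
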